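import Literature.Analysis.FunctionSpaces.TorusSobolevSup
import HarnessLib

/-!
# Smallness interpolation on `𝕋³`: small in `L²` and bounded in `H³` implies small in `C¹`

Analysis/FunctionSpaces support file (everything proved; no definitions, no named facts), sequel of
`TorusSobolevSup.lean` (`H²(T³) ⊂ L^∞`), `TorusSobolevL6.lean` (Ladyzhenskaya's inequality in
three dimensions) and `TorusPoincareMorrey.lean` (Morrey's inequality on `T^d`). It supplies the
elementary interpolation statement which closes continuous-dependence bootstraps for quasilinear
symmetric hyperbolic systems on the flat three-torus (Kato 1975, proof of Thm. III; Majda 1984,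
Ch. 2 §2.1, proof of Thm. 2.2): a difference of two solutions that is SMALL in `L²` (low-order
relative-energy estimate) and BOUNDED in `H³` (high-order energy of each solution separately) is
small in `C¹`.

* `Torus.neg_integral_mul_le` — Young's form of the Cauchy–Schwarz inequality for continuous real
  `u`, `v` on `T^d`: `-∫ u v ≤ (s/2) ∫ u² + (1/(2s)) ∫ v²` for every `s > 0`
  (expand `0 ≤ ∫ (s u + v)²`);
* `Torus.integral_partialDeriv_sq_le` — **the interpolation inequality
  `‖∂ᵢu‖₂² ≤ ‖u‖₂ ‖∂ᵢ²u‖₂` in Young's form**: `∫ (∂ᵢu)² ≤ (s/2) ∫ u² + (1/(2s)) ∫ (∂ᵢ∂ᵢu)²`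
  for smooth real `u` on `T^d` and `s > 0` (integration by parts `∫ (∂ᵢu)² = -∫ u ∂ᵢ∂ᵢu`, no
  boundary terms on the torus);
* `Torus.enorm_pow_four_le_of_hasZeroMean` / `Torus.norm_pow_four_le_of_hasZeroMean` — **a sup
  bound for smooth zero-mean fields on `T³`**: on `T^d` with `card d = 3` there is `K` with
  `‖g x‖⁴ ≤ K (Σⱼ ∫ ‖∂ⱼ g‖²)^{1/2} (Σᵢ Σⱼ ∫ ‖∂ᵢ ∂ⱼ g‖²)^{3/2}` for every smooth `g : T^d → F'`
  with `∫ g = 0` and every `x` (`ℝ≥0∞` form with lower Lebesgue integrals, and Bochner form):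
  Morrey's inequality with `q = 4 > 3` (`Torus.enorm_le_of_hasZeroMean`: `‖g x‖ ≤ 12 ‖Dg‖_{L⁴}`),
  `‖Dg‖_{L⁴} ≤ Σⱼ ‖∂ⱼ g‖_{L⁴}` (`Torus.eLpNorm_norm_fderiv_le_sum`) and Ladyzhenskaya's inequality
  `∫ ‖v‖⁴ ≤ K₄ (∫ ‖v‖²)^{1/2} (∫ ‖Dv‖²)^{3/2}` (`Torus.lintegral_enorm_pow_four_le_of_hasZeroMean`)
  for the smooth zero-mean derivatives `v = ∂ⱼ g` (`∫ ∂ⱼ g = 0`), with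
  `‖D ∂ⱼ g‖² ≤ 3 Σᵢ ‖∂ᵢ ∂ⱼ g‖²` pointwise (`Torus.norm_fderiv_sq_le_card_mul_sum`);
* `Torus.smallness_interpolation_three` — **the smallness interpolation on `𝕋³`**: for every
  real `E` and every `ε > 0` there is `δ > 0` such that every smooth real `f` on
  `𝕋³ = UnitAddTorus (Fin 3)` with `∫ f² ≤ δ` and all `L²` norms (squared) of its nested partial
  derivatives of orders `1, 2, 3` at most `E` satisfies `|f x| ≤ ε` and `|∂ᵢ f x| ≤ ε` for all
  `x` and `i`.

Proof of the last item: put `E' = max E 1` and `δ = η⁴ E'` with `0 < η ≤ 1` to be chosen. The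
interpolation inequality with `s = η⁻²`, resp. `s = η⁻¹` (in the order the derivatives are
written, so that no commutation of partial derivatives is needed), gives `∫ (∂ᵢf)² ≤ η² E'` and
`∫ (∂ᵢ∂ⱼf)² ≤ η E'`; then `H² ⊂ L^∞` (`Torus.exists_norm_sq_le_sobolev_two`) bounds
`|f x|² ≤ 13 K₂ E' η`, and the sup bound for the zero-mean derivative `g = ∂ᵢ f` bounds
`|∂ᵢ f x|⁴ ≤ K₄ (3 E' η)^{1/2} (9 E')^{3/2}`. Both right-hand sides are continuous in `η` and
vanish at `η = 0`, and `η` is chosen accordingly (a limit argument; constants are existential and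
not tracked).

## Mathlib / tree search

Mathlib (this pin): Gagliardo–Nirenberg–Sobolev on `ℝⁿ` (`eLpNorm_le_eLpNorm_fderiv_of_le`), no
Morrey or Agmon inequality, nothing periodic. Tree: `TorusSobolevSup` (`H² ⊂ L^∞` on `T³`,
`Torus.exists_norm_sq_le_sobolev_two`), `TorusPoincareMorrey` (Poincaré–Wirtinger and Morrey on
`T^d`), `TorusSobolevL6` (`H¹ ⊂ L⁶`, Ladyzhenskaya in three dimensions), `TorusL4Interpolation`
(`∫ (∂ⱼh)⁴ ≤ 9 ‖h‖²_∞ ∫ (∂ⱼ²h)²`, sup-norm weighted, not a smallness statement); integration by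
parts `∫ (∂ᵢa) b = -∫ a ∂ᵢb` exists only as private copies or in heavy `FluidPDE` files
(`TorusInvLaplacianGradientLp`, `FluidPDE/TorusPressurePoisson`), hence the private copy below; no
sup bound for zero-mean fields by `‖∂g‖₂^{1/4} ‖∂²g‖₂^{3/4}` (`TorusAgmonLatticeSum` is the
Fourier-side lattice sum of Agmon's inequality only) and no `L²`-small/`H³`-bounded `⇒`
`C¹`-small statement (searched `smallness`, `Agmon`, `norm_pow_four_le`, `le_sobolev`,
`hasZeroMean` under `FunctionSpaces/Torus*`; prior stockroom `lean find`: no matches).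

## References

* T. Kato, *The Cauchy problem for quasi-linear symmetric hyperbolic systems*, Arch. Rational
  Mech. Anal. 58 (1975), 181–205, Thm. III and its proof. [Kato1975]
* A. Majda, *Compressible Fluid Flow and Systems of Conservation Laws in Several Space
  Variables*, Springer 1984, Ch. 2 §2.1, Prop. 2.1 and the proof of Thm. 2.2. [Majda1984]
* R. A. Adams, *Sobolev Spaces*, Academic Press 1975, Thm. 5.4 and Lemma 5.15 (Morrey and the
  imbedding `W^{m,p} → C_B`, `mp > n`). [Adams1975]
* C. Foias, O. Manley, R. Rosa, R. Temam, *Navier–Stokes Equations and Turbulence*, CUP 2001,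
  Ch. II App. A, (A.27) (Ladyzhenskaya's inequality, `n = 3`). [FoiasManleyRosaTemam2001]
* L. C. Evans, *Partial Differential Equations*, 2nd ed., AMS 2010, App. C.2 Thm. 2
  (integration by parts), §5.6.2 Thm. 4 (Morrey). [Evans2010]
-/

noncomputable section

open MeasureTheory Set Filter Function Topology
open scoped ENNReal NNReal ContDiff

namespace Literature.Analysis.FunctionSpaces

namespace Torus

variable {d : Type*} [Fintype d] [DecidableEq d]
variable {F' : Type*} [NormedAddCommGroup F'] [NormedSpace ℝ F'] [FiniteDimensional ℝ F']

/-! ### Young's form of Cauchy–Schwarz and the interpolation inequality -/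

omit [DecidableEq d] in
/-- **Young's form of the Cauchy–Schwarz inequality** for continuous real functions on the torus:
`-∫ u v ≤ (s/2) ∫ u² + (1/(2s)) ∫ v²` for every `s > 0` (expand `0 ≤ ∫ (s u + v)²`; all
densities are continuous on the compact torus, hence integrable). [folklore] -/
theorem neg_integral_mul_le {u v : UnitAddTorus d → ℝ} (hu : Continuous u) (hv : Continuous v)
    {s : ℝ} (hs : 0 < s) :
    -∫ x, u x * v x ≤ s / 2 * (∫ x, u x ^ 2) + 1 / (2 * s) * ∫ x, v x ^ 2 := by
  have hiu : Integrable (fun x => u x ^ 2) volume := (hu.pow 2).integrable_unitAddTorus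
  have hiv : Integrable (fun x => v x ^ 2) volume := (hv.pow 2).integrable_unitAddTorus
  have hiuv : Integrable (fun x => u x * v x) volume := (hu.mul hv).integrable_unitAddTorus
  have hi1 : Integrable (fun x => s ^ 2 * u x ^ 2) volume := hiu.const_mul _
  have hi2 : Integrable (fun x => 2 * s * (u x * v x)) volume := hiuv.const_mul _
  have hi12 : Integrable (fun x => s ^ 2 * u x ^ 2 + 2 * s * (u x * v x)) volume := hi1.add hi2
  have h0 : 0 ≤ ∫ x, (s * u x + v x) ^ 2 := integral_nonneg fun x => sq_nonneg _
  have he : ∫ x, (s * u x + v x) ^ 2 =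
      s ^ 2 * (∫ x, u x ^ 2) + 2 * s * (∫ x, u x * v x) + ∫ x, v x ^ 2 := by
    have e : (fun x => (s * u x + v x) ^ 2) =
        fun x => s ^ 2 * u x ^ 2 + 2 * s * (u x * v x) + v x ^ 2 := by
      funext x; ring
    rw [e, integral_add hi12 hiv, integral_add hi1 hi2, integral_const_mul, integral_const_mul]
  rw [he] at h0
  have hs0 : s ≠ 0 := hs.ne'
  have key : s / 2 * (∫ x, u x ^ 2) + 1 / (2 * s) * (∫ x, v x ^ 2) + ∫ x, u x * v x =
      (s ^ 2 * (∫ x, u x ^ 2) + 2 * s * (∫ x, u x * v x) + ∫ x, v x ^ 2) / (2 * s) := by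
    field_simp
    ring
  have h1 : 0 ≤ s / 2 * (∫ x, u x ^ 2) + 1 / (2 * s) * (∫ x, v x ^ 2) + ∫ x, u x * v x := by
    rw [key]
    exact div_nonneg h0 (by positivity)
  linarith

/-- Integration by parts on the torus: `∫ (∂ᵢa) b = -∫ a (∂ᵢb)` for smooth real `a`, `b`
(`∫ ∂ᵢ(ab) = 0`, no boundary; private copy of the lemma of `TorusInvLaplacianGradientLp` /
`FluidPDE/TorusPressurePoisson`, whose import closure is not wanted here).
[cite: Evans2010, App. C.2 Thm. 2] -/
private theorem integral_partialDeriv_mul_eq_neg_integral' {a b : UnitAddTorus d → ℝ}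
    (ha : IsSmooth a) (hb : IsSmooth b) (i : d) :
    ∫ x, partialDeriv i a x * b x = -∫ x, a x * partialDeriv i b x := by
  have hab : IsSmooth (fun y => a y * b y) := by
    unfold IsSmooth at ha hb ⊢; exact ha.mul hb
  have h0 : ∫ x, partialDeriv i (fun y => a y * b y) x = 0 :=
    integral_partialDeriv_eq_zero_holds hab i
  have e : (fun x => partialDeriv i (fun y => a y * b y) x) =
      fun x => a x * partialDeriv i b x + partialDeriv i a x * b x :=
    funext fun x => partialDeriv_mul (ha.isContDiff (by simp)) (hb.isContDiff (by simp)) i x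
  have hi1 : Integrable (fun x => a x * partialDeriv i b x) volume :=
    (ha.continuous.mul (hb.partialDeriv i).continuous).integrable_unitAddTorus
  have hi2 : Integrable (fun x => partialDeriv i a x * b x) volume :=
    ((ha.partialDeriv i).continuous.mul hb.continuous).integrable_unitAddTorus
  rw [e, integral_add hi1 hi2] at h0
  linarith

/-- **The interpolation inequality `‖∂ᵢu‖₂² ≤ ‖u‖₂ ‖∂ᵢ²u‖₂` in Young's form** (Majda 1984,
Prop. 2.1; Kato 1975, proof of Thm. III): for smooth real `u` on `T^d`, every direction `i` and
every `s > 0`, `∫ (∂ᵢu)² ≤ (s/2) ∫ u² + (1/(2s)) ∫ (∂ᵢ∂ᵢu)²` — integration by parts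
`∫ (∂ᵢu)(∂ᵢu) = -∫ u ∂ᵢ(∂ᵢu)` (no boundary terms on the torus) and `neg_integral_mul_le`.
[folklore] -/
theorem integral_partialDeriv_sq_le {u : UnitAddTorus d → ℝ} (hu : IsSmooth u) (i : d) {s : ℝ}
    (hs : 0 < s) :
    ∫ x, partialDeriv i u x ^ 2 ≤
      s / 2 * (∫ x, u x ^ 2) + 1 / (2 * s) * ∫ x, partialDeriv i (partialDeriv i u) x ^ 2 := by
  have e : ∫ x, partialDeriv i u x ^ 2 = ∫ x, partialDeriv i u x * partialDeriv i u x :=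
    integral_congr_ae (ae_of_all _ fun x => sq _)
  rw [e, integral_partialDeriv_mul_eq_neg_integral' hu (hu.partialDeriv i) i]
  exact neg_integral_mul_le hu.continuous ((hu.partialDeriv i).partialDeriv i).continuous hs

/-! ### A sup bound for smooth zero-mean fields on `T³` (Morrey with `q = 4` and Ladyzhenskaya) -/

omit [DecidableEq d] in
/-- `‖v‖⁴_{L⁴} = ∫ ‖v‖ₑ⁴` on the torus, as a natural-number power.
[folklore] -/
theorem eLpNorm_four_pow_four_eq_lintegral {G : Type*} [NormedAddCommGroup G]
    (v : UnitAddTorus d → G) : eLpNorm v 4 volume ^ 4 = ∫⁻ x, ‖v x‖ₑ ^ 4 := by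
  rw [eLpNorm_eq_lintegral_rpow_enorm_toReal (by norm_num) ENNReal.ofNat_ne_top,
    ENNReal.toReal_ofNat, ← ENNReal.rpow_ofNat _ 4, ← ENNReal.rpow_mul]
  norm_num

omit [DecidableEq d] [NormedSpace ℝ F'] [FiniteDimensional ℝ F'] in
/-- `∫⁻ ‖g‖ₑ² = ofReal (∫ ‖g‖²)` for continuous `g` on the (compact) torus (private copy of the
lemma of `TorusSobolevSup` / `TorusEnstrophyTrilinear`). [folklore] -/
private theorem lintegral_enorm_sq_eq_ofReal_integral_norm_sq_of_continuous
    {g : UnitAddTorus d → F'} (hg : Continuous g) :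
    ∫⁻ y, ‖g y‖ₑ ^ 2 = ENNReal.ofReal (∫ y, ‖g y‖ ^ 2) := by
  have hi : Integrable (fun y => ‖g y‖ ^ 2) volume := (hg.norm.pow 2).integrable_unitAddTorus
  rw [ofReal_integral_eq_lintegral_ofReal hi (ae_of_all _ fun y => sq_nonneg _)]
  exact lintegral_congr fun y => by rw [← ofReal_norm, ENNReal.ofReal_pow (norm_nonneg _)]

/-- **A sup bound for smooth zero-mean fields on `T³`, `ℝ≥0∞` form**: on `T^d` with `card d = 3`
there is `K` (depending only on `d` and the finite-dimensional target `F'`) such that for every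
smooth `g : T^d → F'` with `∫ g = 0` and every `x`,
`‖g x‖⁴ ≤ K (Σⱼ ∫ ‖∂ⱼ g‖²)^{1/2} (Σᵢ Σⱼ ∫ ‖∂ᵢ ∂ⱼ g‖²)^{3/2}`. Proof: Morrey's inequality with
`q = 4 > 3` for the zero-mean map `g` (`Torus.enorm_le_of_hasZeroMean`, `‖g x‖ ≤ 12 ‖Dg‖_{L⁴}`),
`‖Dg‖_{L⁴} ≤ Σⱼ ‖∂ⱼ g‖_{L⁴}` (`Torus.eLpNorm_norm_fderiv_le_sum`), the power mean
`(Σⱼ Nⱼ)⁴ ≤ 27 Σⱼ Nⱼ⁴`, and Ladyzhenskaya's inequality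
(`Torus.lintegral_enorm_pow_four_le_of_hasZeroMean`) for each smooth zero-mean derivative
`v = ∂ⱼ g` (`∫ ∂ⱼ g = 0`, `Torus.integral_partialDeriv_eq_zero_holds`), whose right-hand side is
bounded using `∫ ‖∂ⱼ g‖² ≤ Σⱼ ∫ ‖∂ⱼ g‖²` and `‖D ∂ⱼ g‖² ≤ 3 Σᵢ ‖∂ᵢ ∂ⱼ g‖²`
(`Torus.norm_fderiv_sq_le_card_mul_sum`), `(3 S)^{3/2} ≤ 9 S^{3/2}`. [folklore] -/
theorem enorm_pow_four_le_of_hasZeroMean (hd : Fintype.card d = 3) :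
    ∃ K : ℝ≥0, ∀ g : UnitAddTorus d → F', IsSmooth g → HasZeroMean g → ∀ x,
      ‖g x‖ₑ ^ 4 ≤ K * (∑ j, ∫⁻ y, ‖partialDeriv j g y‖ₑ ^ 2) ^ (1 / 2 : ℝ) *
        (∑ i, ∑ j, ∫⁻ y, ‖partialDeriv i (partialDeriv j g) y‖ₑ ^ 2) ^ (3 / 2 : ℝ) := by
  obtain ⟨K₄, hK₄⟩ := lintegral_enorm_pow_four_le_of_hasZeroMean (F' := F') hd
  refine ⟨12 ^ 4 * 27 * 3 * 9 * K₄, fun g hg h0 x => ?_⟩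
  haveI : CompleteSpace F' := FiniteDimensional.complete ℝ F'
  have hg1 : IsContDiff 1 g := hg.isContDiff (by simp)
  -- ### notation
  set S₁ : ℝ≥0∞ := ∑ j, ∫⁻ y, ‖partialDeriv j g y‖ₑ ^ 2 with hS₁
  set S₂ : ℝ≥0∞ := ∑ i, ∑ j, ∫⁻ y, ‖partialDeriv i (partialDeriv j g) y‖ₑ ^ 2 with hS₂
  set M : ℝ≥0∞ := eLpNorm (fun z => ‖Torus.fderiv g z‖) 4 volume with hM
  set N : d → ℝ≥0∞ := fun j => eLpNorm (partialDeriv j g) 4 volume with hN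
  -- ### Morrey with `q = 4`: `‖g x‖ ≤ 12 ‖Dg‖_{L⁴}`
  have hMorrey : ‖g x‖ₑ ≤ 12 * M := by
    have hd' : (Fintype.card d : ℝ) = 3 := by exact_mod_cast hd
    have h := enorm_le_of_hasZeroMean hg1 h0 (q := 4) (by norm_num) (by rw [hd']; norm_num) x
    rw [hd] at h
    have e : ((3 : ℕ) : ℝ≥0∞) * ENNReal.ofReal (4 / (4 - ((3 : ℕ) : ℝ))) = 12 := by
      rw [show (4 : ℝ) / (4 - ((3 : ℕ) : ℝ)) = 4 by norm_num, ENNReal.ofReal_ofNat]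
      norm_num
    rw [e, ENNReal.ofReal_ofNat] at h
    exact h
  -- ### `‖Dg‖_{L⁴} ≤ Σⱼ ‖∂ⱼ g‖_{L⁴}`
  have hMsum : M ≤ ∑ j, N j := eLpNorm_norm_fderiv_le_sum hg1 (p := 4) (by norm_num)
  -- ### Ladyzhenskaya for each zero-mean derivative `∂ⱼ g`
  have hN4 : ∀ j, N j ^ 4 ≤ (K₄ : ℝ≥0∞) * S₁ ^ (1 / 2 : ℝ) * (9 * S₂ ^ (3 / 2 : ℝ)) := by
    intro j
    have hv : IsSmooth (partialDeriv j g) := hg.partialDeriv j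
    have hv1 : IsContDiff 1 (partialDeriv j g) := hv.isContDiff (by simp)
    have hv0 : HasZeroMean (partialDeriv j g) := integral_partialDeriv_eq_zero_holds hg j
    -- `∫ ‖∂ⱼ g‖² ≤ S₁`
    have ha : ∫⁻ y, ‖partialDeriv j g y‖ₑ ^ 2 ≤ S₁ :=
      Finset.single_le_sum (f := fun j => ∫⁻ y, ‖partialDeriv j g y‖ₑ ^ 2)
        (fun _ _ => zero_le) (Finset.mem_univ j)
    -- `∫ ‖D ∂ⱼ g‖² ≤ 3 Σᵢ ∫ ‖∂ᵢ ∂ⱼ g‖² ≤ 3 S₂`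
    have hpt : ∀ y, ‖Torus.fderiv (partialDeriv j g) y‖ₑ ^ 2 ≤
        3 * ∑ i, ‖partialDeriv i (partialDeriv j g) y‖ₑ ^ 2 := by
      intro y
      have h := norm_fderiv_sq_le_card_mul_sum hv1 y
      rw [hd] at h
      push_cast at h
      rw [← ofReal_norm, ← ENNReal.ofReal_pow (norm_nonneg _)]
      refine (ENNReal.ofReal_le_ofReal h).trans (le_of_eq ?_)
      rw [ENNReal.ofReal_mul (by norm_num), ENNReal.ofReal_ofNat,
        ENNReal.ofReal_sum_of_nonneg (fun i _ => sq_nonneg _)]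
      congr 1
      refine Finset.sum_congr rfl fun i _ => ?_
      rw [ENNReal.ofReal_pow (norm_nonneg _), ofReal_norm]
    have hmeas : ∀ i, Measurable fun y => ‖partialDeriv i (partialDeriv j g) y‖ₑ ^ 2 :=
      fun i => (hv.partialDeriv i).continuous.enorm.measurable.pow_const 2
    have hb : ∫⁻ y, ‖Torus.fderiv (partialDeriv j g) y‖ₑ ^ 2 ≤ 3 * S₂ := by
      calc ∫⁻ y, ‖Torus.fderiv (partialDeriv j g) y‖ₑ ^ 2
          ≤ ∫⁻ y, 3 * ∑ i, ‖partialDeriv i (partialDeriv j g) y‖ₑ ^ 2 := lintegral_mono hpt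
        _ = 3 * ∑ i, ∫⁻ y, ‖partialDeriv i (partialDeriv j g) y‖ₑ ^ 2 := by
            rw [lintegral_const_mul _ (Finset.measurable_sum _ fun i _ => hmeas i),
              lintegral_finsetSum _ fun i _ => hmeas i]
        _ ≤ 3 * S₂ := by
            refine mul_le_mul' le_rfl (Finset.sum_le_sum fun i _ => ?_)
            exact Finset.single_le_sum
              (f := fun j => ∫⁻ y, ‖partialDeriv i (partialDeriv j g) y‖ₑ ^ 2)
              (fun _ _ => zero_le) (Finset.mem_univ j)
    -- `(3 S₂)^{3/2} ≤ 9 S₂^{3/2}`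
    have h3 : (3 * S₂) ^ (3 / 2 : ℝ) ≤ 9 * S₂ ^ (3 / 2 : ℝ) := by
      rw [ENNReal.mul_rpow_of_nonneg _ _ (by norm_num : (0 : ℝ) ≤ 3 / 2)]
      refine mul_le_mul' ?_ le_rfl
      calc (3 : ℝ≥0∞) ^ (3 / 2 : ℝ) ≤ 3 ^ (2 : ℝ) :=
            ENNReal.rpow_le_rpow_of_exponent_le (by norm_num) (by norm_num)
        _ = 9 := by rw [ENNReal.rpow_two]; norm_num
    calc N j ^ 4 = ∫⁻ y, ‖partialDeriv j g y‖ₑ ^ 4 := eLpNorm_four_pow_four_eq_lintegral _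
      _ ≤ K₄ * (∫⁻ y, ‖partialDeriv j g y‖ₑ ^ 2) ^ (1 / 2 : ℝ) *
          (∫⁻ y, ‖Torus.fderiv (partialDeriv j g) y‖ₑ ^ 2) ^ (3 / 2 : ℝ) := hK₄ _ hv hv0
      _ ≤ K₄ * S₁ ^ (1 / 2 : ℝ) * (3 * S₂) ^ (3 / 2 : ℝ) := by gcongr
      _ ≤ K₄ * S₁ ^ (1 / 2 : ℝ) * (9 * S₂ ^ (3 / 2 : ℝ)) := by gcongr
  -- ### power mean `(Σⱼ Nⱼ)⁴ ≤ 27 Σⱼ Nⱼ⁴`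
  have hpm : (∑ j, N j) ^ 4 ≤ 27 * ∑ j, N j ^ 4 := by
    have h := ENNReal.rpow_sum_le_const_mul_sum_rpow (s := (Finset.univ : Finset d)) (f := N)
      (p := 4) (by norm_num)
    rw [Finset.card_univ, hd] at h
    norm_num at h
    exact h
  -- ### assembly
  calc ‖g x‖ₑ ^ 4 ≤ (12 * M) ^ 4 := by gcongr
    _ ≤ (12 * ∑ j, N j) ^ 4 := by gcongr
    _ = 12 ^ 4 * (∑ j, N j) ^ 4 := by rw [mul_pow]
    _ ≤ 12 ^ 4 * (27 * ∑ j, N j ^ 4) := by gcongr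
    _ ≤ 12 ^ 4 * (27 * ∑ _j : d, (K₄ : ℝ≥0∞) * S₁ ^ (1 / 2 : ℝ) * (9 * S₂ ^ (3 / 2 : ℝ))) := by
        gcongr with j _
        exact hN4 j
    _ = ((12 ^ 4 * 27 * 3 * 9 * K₄ : ℝ≥0) : ℝ≥0∞) * S₁ ^ (1 / 2 : ℝ) * S₂ ^ (3 / 2 : ℝ) := by
        rw [Finset.sum_const, Finset.card_univ, hd, nsmul_eq_mul]
        push_cast
        ring

/-- **A sup bound for smooth zero-mean fields on `T³`, Bochner form**: on `T^d` with `card d = 3`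
there is a real `K > 0` such that for every smooth `g : T^d → F'` with `∫ g = 0` and every `x`,
`‖g x‖⁴ ≤ K (Σⱼ ∫ ‖∂ⱼ g‖²)^{1/2} (Σᵢ Σⱼ ∫ ‖∂ᵢ ∂ⱼ g‖²)^{3/2}` with the Bochner integrals of the
(continuous, hence integrable) densities and real powers (from
`enorm_pow_four_le_of_hasZeroMean`). [folklore] -/
theorem norm_pow_four_le_of_hasZeroMean (hd : Fintype.card d = 3) :
    ∃ K : ℝ, 0 < K ∧ ∀ g : UnitAddTorus d → F', IsSmooth g → HasZeroMean g → ∀ x,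
      ‖g x‖ ^ 4 ≤ K * (∑ j, ∫ y, ‖partialDeriv j g y‖ ^ 2) ^ (1 / 2 : ℝ) *
        (∑ i, ∑ j, ∫ y, ‖partialDeriv i (partialDeriv j g) y‖ ^ 2) ^ (3 / 2 : ℝ) := by
  obtain ⟨K, hK⟩ := enorm_pow_four_le_of_hasZeroMean (F' := F') hd
  refine ⟨K + 1, by positivity, fun g hg h0 x => ?_⟩
  have h := hK g hg h0 x
  set b : d → ℝ := fun j => ∫ y, ‖partialDeriv j g y‖ ^ 2 with hb
  set c : d → d → ℝ := fun i j => ∫ y, ‖partialDeriv i (partialDeriv j g) y‖ ^ 2 with hc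
  have hb0 : ∀ j, 0 ≤ b j := fun j => integral_nonneg fun _ => sq_nonneg _
  have hc0 : ∀ i j, 0 ≤ c i j := fun i j => integral_nonneg fun _ => sq_nonneg _
  have hsb0 : 0 ≤ ∑ j, b j := Finset.sum_nonneg fun j _ => hb0 j
  have hsc0 : ∀ i, 0 ≤ ∑ j, c i j := fun i => Finset.sum_nonneg fun j _ => hc0 i j
  have hssc0 : 0 ≤ ∑ i, ∑ j, c i j := Finset.sum_nonneg fun i _ => hsc0 i
  have hK0 : (0 : ℝ) ≤ K := NNReal.coe_nonneg K
  have hR0 : 0 ≤ (K : ℝ) * (∑ j, b j) ^ (1 / 2 : ℝ) * (∑ i, ∑ j, c i j) ^ (3 / 2 : ℝ) :=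
    mul_nonneg (mul_nonneg hK0 (Real.rpow_nonneg hsb0 _)) (Real.rpow_nonneg hssc0 _)
  -- the densities as `ofReal` of real integrals
  have eB : ∑ j, ∫⁻ y, ‖partialDeriv j g y‖ₑ ^ 2 = ENNReal.ofReal (∑ j, b j) := by
    rw [ENNReal.ofReal_sum_of_nonneg fun j _ => hb0 j]
    exact Finset.sum_congr rfl fun j _ =>
      lintegral_enorm_sq_eq_ofReal_integral_norm_sq_of_continuous (hg.partialDeriv j).continuous
  have eC : ∑ i, ∑ j, ∫⁻ y, ‖partialDeriv i (partialDeriv j g) y‖ₑ ^ 2 =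
      ENNReal.ofReal (∑ i, ∑ j, c i j) := by
    rw [ENNReal.ofReal_sum_of_nonneg fun i _ => hsc0 i]
    refine Finset.sum_congr rfl fun i _ => ?_
    rw [ENNReal.ofReal_sum_of_nonneg fun j _ => hc0 i j]
    exact Finset.sum_congr rfl fun j _ =>
      lintegral_enorm_sq_eq_ofReal_integral_norm_sq_of_continuous
        ((hg.partialDeriv j).partialDeriv i).continuous
  have eL : ‖g x‖ₑ ^ 4 = ENNReal.ofReal (‖g x‖ ^ 4) := by
    rw [← ofReal_norm, ENNReal.ofReal_pow (norm_nonneg _)]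
  rw [eB, eC, eL, ENNReal.ofReal_rpow_of_nonneg hsb0 (by norm_num),
    ENNReal.ofReal_rpow_of_nonneg hssc0 (by norm_num), ← ENNReal.ofReal_coe_nnreal,
    ← ENNReal.ofReal_mul hK0, ← ENNReal.ofReal_mul (mul_nonneg hK0 (Real.rpow_nonneg hsb0 _)),
    ENNReal.ofReal_le_ofReal_iff hR0] at h
  calc ‖g x‖ ^ 4 ≤ K * (∑ j, b j) ^ (1 / 2 : ℝ) * (∑ i, ∑ j, c i j) ^ (3 / 2 : ℝ) := h
    _ ≤ (K + 1) * (∑ j, b j) ^ (1 / 2 : ℝ) * (∑ i, ∑ j, c i j) ^ (3 / 2 : ℝ) := by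
        refine mul_le_mul_of_nonneg_right (mul_le_mul_of_nonneg_right ?_ (Real.rpow_nonneg hsb0 _))
          (Real.rpow_nonneg hssc0 _)
        exact le_add_of_nonneg_right zero_le_one

end Torus

/-- **Smallness interpolation on `𝕋³`: small in `L²` and bounded in `H³` implies small in `C¹`**
(the interpolation step closing the continuous-dependence bootstrap of Kato 1975, Thm. III /
Majda 1984, Thm. 2.2, for quasilinear symmetric hyperbolic systems on the flat three-torus). For
every real `E` and every `ε > 0` there is `δ > 0` such that every smooth real `f` on
`𝕋³ = UnitAddTorus (Fin 3)` with `∫ f² ≤ δ` whose nested partial derivatives of orders `1`, `2`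
and `3` all have `∫ (∂…f)² ≤ E` satisfies `|f x| ≤ ε` and `|∂ᵢ f x| ≤ ε` for every `x` and `i`.
Proof: with `E' = max E 1`, `δ = η⁴ E'`, the interpolation inequality
`Torus.integral_partialDeriv_sq_le` (with `s = η⁻²`, resp. `s = η⁻¹`) gives `∫ (∂ᵢf)² ≤ η² E'`
and `∫ (∂ᵢ∂ⱼf)² ≤ η E'`; `H² ⊂ L^∞` (`Torus.exists_norm_sq_le_sobolev_two`) gives
`|f x|² ≤ 13 K₂ E' η`, and the zero-mean sup bound `Torus.norm_pow_four_le_of_hasZeroMean` for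
`g = ∂ᵢ f` (`∫ ∂ᵢ f = 0`) gives `|∂ᵢ f x|⁴ ≤ K₄ (3 E' η)^{1/2} (9 E')^{3/2}`; `η ∈ (0, 1]` is
chosen with both right-hand sides below `ε²`, resp. `ε⁴` (they tend to `0` with `η`). [folklore] -/
theorem Torus.smallness_interpolation_three :
    ∀ E ε : ℝ, 0 < ε → ∃ δ : ℝ, 0 < δ ∧ ∀ f : UnitAddTorus (Fin 3) → ℝ, Torus.IsSmooth f →
      (∫ x, f x ^ 2) ≤ δ →
      (∀ i : Fin 3, (∫ x, Torus.partialDeriv i f x ^ 2) ≤ E) →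
      (∀ i j : Fin 3, (∫ x, Torus.partialDeriv i (Torus.partialDeriv j f) x ^ 2) ≤ E) →
      (∀ i j l : Fin 3,
        (∫ x, Torus.partialDeriv i (Torus.partialDeriv j (Torus.partialDeriv l f)) x ^ 2) ≤ E) →
      ∀ x, |f x| ≤ ε ∧ ∀ i : Fin 3, |Torus.partialDeriv i f x| ≤ ε := by
  intro E ε hε
  -- ### the two constants and `E' = max E 1`
  obtain ⟨K₂, hK₂, hsup⟩ := Torus.exists_norm_sq_le_sobolev_two ℝ
  obtain ⟨K₄, hK₄, hsup4⟩ :=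
    Torus.norm_pow_four_le_of_hasZeroMean (d := Fin 3) (F' := ℝ) (Fintype.card_fin 3)
  obtain ⟨E', hEE', hE'1⟩ : ∃ E' : ℝ, E ≤ E' ∧ 1 ≤ E' :=
    ⟨max E 1, le_max_left _ _, le_max_right _ _⟩
  have hE'0 : 0 < E' := lt_of_lt_of_le one_pos hE'1
  -- ### the two moduli of smallness and the choice of `η`
  have hΦ : Tendsto (fun η : ℝ => 13 * K₂ * E' * η) (𝓝[>] 0) (𝓝 0) := by
    have hc : Continuous fun η : ℝ => 13 * K₂ * E' * η := by fun_prop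
    exact (hc.tendsto' 0 0 (by simp)).mono_left nhdsWithin_le_nhds
  have hΨ : Tendsto (fun η : ℝ => K₄ * (3 * E' * η) ^ (1 / 2 : ℝ) * (9 * E') ^ (3 / 2 : ℝ))
      (𝓝[>] 0) (𝓝 0) := by
    have hc : Continuous fun η : ℝ => K₄ * (3 * E' * η) ^ (1 / 2 : ℝ) * (9 * E') ^ (3 / 2 : ℝ) :=
      (continuous_const.mul ((continuous_const.mul continuous_id).rpow_const
        fun _ => Or.inr (by norm_num))).mul continuous_const
    refine (hc.tendsto' 0 0 ?_).mono_left nhdsWithin_le_nhds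
    simp
  obtain ⟨η, ⟨hΦη, hΨη⟩, hη0, hη1⟩ :=
    (((hΦ.eventually (eventually_lt_nhds (pow_pos hε 2))).and
      (hΨ.eventually (eventually_lt_nhds (pow_pos hε 4)))).and (Ioc_mem_nhdsGT zero_lt_one)).exists
  refine ⟨η ^ 4 * E', by positivity, fun f hf ha _ hC hD x => ?_⟩
  have hη0' : η ≠ 0 := hη0.ne'
  -- ### interpolation: the norms of orders `0, 1, 2` are all `≤ η E'`
  have hη41 : η ^ 4 ≤ η := pow_le_of_le_one hη0.le hη1 (by norm_num)
  have hη21 : η ^ 2 ≤ η := pow_le_of_le_one hη0.le hη1 (by norm_num)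
  have ha' : ∫ y, f y ^ 2 ≤ η * E' := ha.trans (mul_le_mul_of_nonneg_right hη41 hE'0.le)
  have hB' : ∀ i, ∫ y, Torus.partialDeriv i f y ^ 2 ≤ η ^ 2 * E' := fun i =>
    calc ∫ y, Torus.partialDeriv i f y ^ 2
        ≤ (1 / η ^ 2) / 2 * (∫ y, f y ^ 2) +
          1 / (2 * (1 / η ^ 2)) * ∫ y, Torus.partialDeriv i (Torus.partialDeriv i f) y ^ 2 :=
          Torus.integral_partialDeriv_sq_le hf i (by positivity)
      _ ≤ (1 / η ^ 2) / 2 * (η ^ 4 * E') + 1 / (2 * (1 / η ^ 2)) * E' :=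
          add_le_add (mul_le_mul_of_nonneg_left ha (by positivity))
            (mul_le_mul_of_nonneg_left ((hC i i).trans hEE') (by positivity))
      _ = η ^ 2 * E' := by field_simp; ring
  have hB'' : ∀ i, ∫ y, Torus.partialDeriv i f y ^ 2 ≤ η * E' := fun i =>
    (hB' i).trans (mul_le_mul_of_nonneg_right hη21 hE'0.le)
  have hC' : ∀ i j, ∫ y, Torus.partialDeriv i (Torus.partialDeriv j f) y ^ 2 ≤ η * E' := fun i j =>
    calc ∫ y, Torus.partialDeriv i (Torus.partialDeriv j f) y ^ 2
        ≤ (1 / η) / 2 * (∫ y, Torus.partialDeriv j f y ^ 2) +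
          1 / (2 * (1 / η)) *
            ∫ y, Torus.partialDeriv i (Torus.partialDeriv i (Torus.partialDeriv j f)) y ^ 2 :=
          Torus.integral_partialDeriv_sq_le (hf.partialDeriv j) i (by positivity)
      _ ≤ (1 / η) / 2 * (η ^ 2 * E') + 1 / (2 * (1 / η)) * E' :=
          add_le_add (mul_le_mul_of_nonneg_left (hB' j) (by positivity))
            (mul_le_mul_of_nonneg_left ((hD i i j).trans hEE') (by positivity))
      _ = η * E' := by field_simp; ring
  refine ⟨?_, fun i => ?_⟩
  · -- ### `|f x| ≤ ε` from `H² ⊂ L^∞`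
    have h := hsup f hf x
    simp only [Real.norm_eq_abs, sq_abs] at h
    have hs1 : ∑ i, ∫ y, Torus.partialDeriv i f y ^ 2 ≤ ∑ _i : Fin 3, η * E' :=
      Finset.sum_le_sum fun i _ => hB'' i
    have hs2 : ∑ i, ∑ j, ∫ y, Torus.partialDeriv i (Torus.partialDeriv j f) y ^ 2 ≤
        ∑ _i : Fin 3, ∑ _j : Fin 3, η * E' :=
      Finset.sum_le_sum fun i _ => Finset.sum_le_sum fun j _ => hC' i j
    have h2 : f x ^ 2 < ε ^ 2 :=
      calc f x ^ 2 ≤ _ := h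
        _ ≤ K₂ * (η * E' + (∑ _i : Fin 3, η * E') + ∑ _i : Fin 3, ∑ _j : Fin 3, η * E') :=
            mul_le_mul_of_nonneg_left (add_le_add (add_le_add ha' hs1) hs2) hK₂.le
        _ = 13 * K₂ * E' * η := by
            simp only [Finset.sum_const, Finset.card_univ, Fintype.card_fin, nsmul_eq_mul,
              Nat.cast_ofNat]
            ring
        _ < ε ^ 2 := hΦη
    exact (abs_lt_of_sq_lt_sq h2 hε.le).le
  · -- ### `|∂ᵢ f x| ≤ ε` from the zero-mean sup bound applied to `g = ∂ᵢ f`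
    have hg : Torus.IsSmooth (Torus.partialDeriv i f) := hf.partialDeriv i
    have hg0 : Torus.HasZeroMean (Torus.partialDeriv i f) :=
      Torus.integral_partialDeriv_eq_zero_holds hf i
    have h := hsup4 _ hg hg0 x
    simp only [Real.norm_eq_abs, sq_abs] at h
    have hS₁ : ∑ j, ∫ y, Torus.partialDeriv j (Torus.partialDeriv i f) y ^ 2 ≤ 3 * E' * η :=
      calc ∑ j, ∫ y, Torus.partialDeriv j (Torus.partialDeriv i f) y ^ 2
          ≤ ∑ _j : Fin 3, η * E' := Finset.sum_le_sum fun j _ => hC' j i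
        _ = 3 * E' * η := by
            simp only [Finset.sum_const, Finset.card_univ, Fintype.card_fin, nsmul_eq_mul,
              Nat.cast_ofNat]
            ring
    have hS₂ : ∑ j, ∑ l,
        ∫ y, Torus.partialDeriv j (Torus.partialDeriv l (Torus.partialDeriv i f)) y ^ 2 ≤ 9 * E' :=
      calc ∑ j, ∑ l, ∫ y, Torus.partialDeriv j (Torus.partialDeriv l (Torus.partialDeriv i f)) y ^ 2
          ≤ ∑ _j : Fin 3, ∑ _l : Fin 3, E' :=
            Finset.sum_le_sum fun j _ => Finset.sum_le_sum fun l _ => (hD j l i).trans hEE'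
        _ = 9 * E' := by
            simp only [Finset.sum_const, Finset.card_univ, Fintype.card_fin, nsmul_eq_mul,
              Nat.cast_ofNat]
            ring
    have hS₁0 : 0 ≤ ∑ j, ∫ y, Torus.partialDeriv j (Torus.partialDeriv i f) y ^ 2 :=
      Finset.sum_nonneg fun j _ => integral_nonneg fun _ => sq_nonneg _
    have hS₂0 : 0 ≤ ∑ j, ∑ l,
        ∫ y, Torus.partialDeriv j (Torus.partialDeriv l (Torus.partialDeriv i f)) y ^ 2 :=
      Finset.sum_nonneg fun j _ => Finset.sum_nonneg fun l _ => integral_nonneg fun _ => sq_nonneg _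
    have h4 : |Torus.partialDeriv i f x| ^ 4 < ε ^ 4 :=
      calc |Torus.partialDeriv i f x| ^ 4 ≤ _ := h
        _ ≤ K₄ * (3 * E' * η) ^ (1 / 2 : ℝ) * (9 * E') ^ (3 / 2 : ℝ) :=
            mul_le_mul (mul_le_mul_of_nonneg_left (Real.rpow_le_rpow hS₁0 hS₁ (by norm_num)) hK₄.le)
              (Real.rpow_le_rpow hS₂0 hS₂ (by norm_num)) (Real.rpow_nonneg hS₂0 _)
              (mul_nonneg hK₄.le (Real.rpow_nonneg (by positivity) _))
        _ < ε ^ 4 := hΨη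
    exact (lt_of_pow_lt_pow_left₀ 4 hε.le h4).le

end Literature.Analysis.FunctionSpaces

end
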